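import Summits.KontsevichZagierPeriods.KontsevichZagierPeriods.Theorems.HurwitzMicroSectorsNormalFormPrincipleLevelOne
import Summits.KontsevichZagierPeriods.KontsevichZagierPeriods.Theorems.HurwitzMicroSectorsNormalFormPrincipleSlabASubPtK20
import Summits.KontsevichZagierPeriods.KontsevichZagierPeriods.Theorems.HurwitzMicroSectorsNormalFormPrincipleAlgCarriers
import Summits.KontsevichZagierPeriods.KontsevichZagierPeriods.Theorems.HurwitzMicroSectorsNormalFormPrincipleM2FiveZetaTwo
import Literature.NumberTheory.Transcendental.BoxIntegralZetaValues

/-!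
# `NormalFormPrinciple` (stmt-KontsevichZagierPeriods-3869), line `SketchIdeator1` — leaf `stub_boxRigidity`:
# the even zeta values layer: values of the constant box and of the zeta box

Registered sub-goal `value_kit` of the layer "even zeta values" (lead file `…EvenZeta`, seat c8).
The normal form of a diagonal level-one box of even weight `w = 2k` is `[(0,1)^w, β/(1 − Πxₗ)] + [pt, q]`,
reached through constant boxes `[(0,1)^n, c]` of all dimensions `n ≤ w`. This file computes the values
of these pieces:

1. `[(0,1)^w, c].value = c` for every `w`: the open unit box of `Fin w → ℝ` is the product set
   `Set.pi univ (fun _ => Ioo 0 1)` of Lebesgue volume `∏_{i < w} (1 − 0) = 1` (for `w = 0` the empty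
   product: the box is the one-point space `Fin 0 → ℝ`, of volume `1`), and the set integral of a
   constant is `volume · c` (`setIntegral_const`);
2. `[(0,1)^w, c/(1 − Πxₗ)].value = c · ζ(w)` for `w ≥ 2`: pull the constant out of the set integral
   and use the tree's `∫_{(0,1)^w} dx/(1 − Πxₗ) = zetaValue w`
   (`BoxIntegral.setIntegral_box_one_div_one_sub_prod_eq_zetaValue`).

In both cases the integrand is only known on the domain (`EqOn`), which is all the set integral sees
(`setIntegral_congr_fun` over the measurable domain of an integral representation).

References: M. Kontsevich, D. Zagier, *Periods* (2001), §1.1–1.2; F. Beukers, Bull. LMS 11 (1979).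
No new definitions.
-/

noncomputable section

open MeasureTheory Set
open Literature.NumberTheory.Transcendental Literature.NumberTheory.Transcendental.KZ
open Literature.ModelTheory.ExponentialFields (IsSemialgebraic)

namespace Summit.KontsevichZagierPeriods.HurwitzMicroSectors.NormalFormPrinciple.PiBox.EvenZeta

/-! ## The volume of the open unit box -/

/-- **The open unit box `{x : Fin w → ℝ | ∀ i, 0 < x i < 1}` has Lebesgue volume `1`** (as a real
number), in every dimension `w`: it is the product set `Set.pi univ (fun _ => Ioo 0 1)`
(`Beukers.setOf_forall_mem_Ioo_eq_pi`), of volume `∏_{i < w} (1 − 0) = 1` (`Real.volume_pi_Ioo`);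
for `w = 0` this is the empty product (the one-point space `Fin 0 → ℝ`).
[cite: KontsevichZagier2001, §1.1] -/
theorem ez_volume_real_box (w : ℕ) :
    (volume : Measure (Fin w → ℝ)).real {x | ∀ i, x i ∈ Set.Ioo (0:ℝ) 1} = 1 := by
  rw [measureReal_def, Beukers.setOf_forall_mem_Ioo_eq_pi,
    Real.volume_pi_Ioo (a := fun _ => (0:ℝ)) (b := fun _ => (1:ℝ))]
  simp

/-! ## (1) The value of a constant box -/

/-- **Value of a constant box.** An integral representation of dimension `w` on the open unit box
whose integrand agrees with the constant `c` on the box represents `c`: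
`∫_{(0,1)^w} c = volume((0,1)^w) · c = c` (`setIntegral_const` and `ez_volume_real_box`; for `w = 0`
the box is the one-point space and the value is the value `c` of the integrand at that point).
[cite: KontsevichZagier2001, §1.1] -/
theorem ez_value_constBox (w : ℕ) (c : ℝ) (N : IntegralRep w)
    (hNd : N.domain = {x | ∀ i, x i ∈ Set.Ioo (0:ℝ) 1})
    (hNi : EqOn N.integrand (fun _ => c) N.domain) : N.value = c := by
  rw [KZ.IntegralRep.value, setIntegral_congr_fun (KZ.IntegralRep.measurableSet_domain_holds N) hNi,
    setIntegral_const, hNd, ez_volume_real_box, one_smul]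

/-! ## (2) The value of a zeta box -/

/-- **Value of a zeta box.** An integral representation of dimension `w ≥ 2` on the open unit box
whose integrand agrees with `c/(1 − x₀⋯x_{w−1})` on the box represents `c · ζ(w)`: pull the constant
out of the set integral (`c/d = c · (1/d)`, `integral_const_mul`) and use
`∫_{(0,1)^w} dx/(1 − x₀⋯x_{w−1}) = zetaValue w`
(`BoxIntegral.setIntegral_box_one_div_one_sub_prod_eq_zetaValue`, geometric series integrated
term-wise). [cite: KontsevichZagier2001, §1.1] -/
theorem ez_value_zetaBox (w : ℕ) (c : ℝ) (N : IntegralRep w) (hw : 2 ≤ w)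
    (hNd : N.domain = {x | ∀ i, x i ∈ Set.Ioo (0:ℝ) 1})
    (hNi : EqOn N.integrand (fun x => c / (1 - ∏ l, x l)) N.domain) :
    N.value = c * zetaValue w := by
  rw [KZ.IntegralRep.value, setIntegral_congr_fun (KZ.IntegralRep.measurableSet_domain_holds N) hNi,
    hNd]
  simp_rw [div_eq_mul_one_div c]
  rw [integral_const_mul, BoxIntegral.setIntegral_box_one_div_one_sub_prod_eq_zetaValue hw]

/-! ## The registered stub -/

/-- **Stub Z4 (values): `[(0,1)^w, c].value = c` and `[(0,1)^w, c/(1 − Πxₗ)].value = c·ζ(w)` (`w ≥ 2`).**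
The first conjunct is `ez_value_constBox` (volume of the open unit box is `1` in every dimension,
including the one-point box of dimension `0`), the second is `ez_value_zetaBox` (the constant pulled
out of the tree's box integral `∫_{(0,1)^w} dx/(1 − Πxₗ) = zetaValue w`).
[cite: KontsevichZagier2001, §1.1] -/
theorem value_kit :
    (∀ (w : ℕ) (c : ℝ) (N : IntegralRep w), N.domain = {x | ∀ i, x i ∈ Set.Ioo (0:ℝ) 1} →
      EqOn N.integrand (fun _ => c) N.domain → N.value = c) ∧
    (∀ (w : ℕ) (c : ℝ) (N : IntegralRep w), 2 ≤ w → N.domain = {x | ∀ i, x i ∈ Set.Ioo (0:ℝ) 1} →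
      EqOn N.integrand (fun x => c / (1 - ∏ l, x l)) N.domain → N.value = c * zetaValue w) :=
  ⟨fun w c N hNd hNi => ez_value_constBox w c N hNd hNi,
    fun w c N hw hNd hNi => ez_value_zetaBox w c N hw hNd hNi⟩

end Summit.KontsevichZagierPeriods.HurwitzMicroSectors.NormalFormPrinciple.PiBox.EvenZeta
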